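import Summits.BirchSwinnertonDyer.BirchSwinnertonDyer.Theorems.ByReductionTypeAtTwoAdditiveKatoTransportDefs
import Literature.NumberTheory.EllipticCurves.Kato2004.DivisibilityInputsExceptionalTransportProofs
import HarnessLib

/-!
# Route ByReductionTypeAtTwo, crux `AdditiveRankZeroAtTwo` (stmt-BirchSwinnertonDyer-19098) — the TRANSPORT road
# at the object level: Kato's one-sided main conjecture (Conj. 17.6's inequality `ℓ_𝔮(X(E/ℚ_∞)) ≤ ord_𝔮 L̃`)
# at EVERY height-one `𝔮 ∌ 2` — the exceptional prime of (12.5.1) INCLUDED — for an ADDITIVE curve whose twist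
# by `−1` is split multiplicative at `2`, from the odd-branch package `AddKatoTwo.KatoOddBranchInputsAtTwoNegOneSplitTwist`
# (T20 (b)), `Kato2004.thm12_4`, Greenberg's `ι(char X) = char X` and the functional equation `(ι L̃) = (L̃)`,
# by the PROVED module theory `Kato2004/DivisibilityInputsExceptionalTransportProofs.lean` (theorems only)

Seat `bsd-2adic-addL2x` GEN 16 (T20 of `…AdditiveKatoTransportDefs.lean`). HONEST FRAMING (cell `bsd-2adic`, HUMAN
RULING D-0036/D-0054): theorems CONDITIONAL on named inputs (two named facts/targets by name + two hypotheses stated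
on the pinned objects); types-the-object-of; closes none; nothing booked; BSD is not proved by any of this.

What is proved here. §1: the exceptional prime `𝔮₀ = (T + 4/5) = (5T + 4)` (resp. its spelling `(T − 4)`) and
its `ι`-conjugate never BOTH contain the factor `π`, at any prime `𝔮 ∌ 2` — elementary: `(1+T)·ι(T−4) = −(5T+4)`
and `(5T+4) − 5(T−4) = 24 = 2³·3`. §2: for `W` on the (−1)-block with `W[2]` irreducible and EVERY height-one
`𝔮 ∌ 2`, **`ℓ_𝔮(X(W/ℚ_∞)) ≤ ℓ_𝔮(Λ/(L̃))`** (`L̃ ∈ Λ` any integral multiple `2^m·L⁻` of the odd branch of the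
one-term Mazur–Tate–Teitelbaum measure of `W^{(−1)}` with `(ι L̃) = (L̃)`), GIVEN: `Kato2004.thm12_4` (Kato Thm.
12.4 (2), PRINT), `KatoOddBranchInputsAtTwoNegOneSplitTwist` (T20 (b), the ONE input owed at `2`), and on the pinned
dual Selmer datum `D` the symmetry `ι(char D.X) = char D.X` (T20 (a): Greenberg LNM 1716 Thm. 1.14 over `ℚ(i)` and
over `ℚ` for `W^{(−1)}` + the twist decomposition + torsion of `X(W^{(−1)}/ℚ_∞)`) — off `(π)` directly from the
package (`MultDivisibilityInputs.lengthAt_X_le_off_factor`), at `(π)` by transport (`…lengthAt_X_le_at_factor_of_transport`).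
This is the `X`-currency of T20 (e) (`ℓ_{𝔮₀}(X) ≤ ord_{𝔮₀} L⁻`, equivalently Conj. 12.10's inequality at `𝔮₀` by
§17.13): the `+2` of T18 is gone at the object level. The passage from here to `#Ш` (readings T1–T14 / Miller
currency) is NOT made in this file (it is the reading content of `KatoSharpAtTwoAdditiveNegOneSplitTwist`).

References: [Kato2004Asterisque] Thm. 12.4 (2) (p. 221), Thm. 12.5 (3) and (12.5.1) (p. 222), Conj. 12.10 (p. 224),
Conj. 17.6 (p. 274), §17.13 (pp. 279–280); [GreenbergLNM1716] Thm. 1.14 (p. 68); [MazurTateTeitelbaum1986Invent]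
§I.10, §I.13, §I.17; memo `run/shared/lean/pub/bsd-2adic/addL2x/VERDICT-19098-addL2x-GEN16.md`.
-/

set_option autoImplicit false
-- the summit's namespace `Summit.BirchSwinnertonDyer.BirchSwinnertonDyer` (Sub = Summit) trips `dupNamespace`
set_option linter.dupNamespace false

noncomputable section

open scoped Classical MatrixGroups ModularForm

open Field CongruenceSubgroup WeierstrassCurve Literature.NumberTheory.EllipticCurves
  Literature.NumberTheory.EllipticCurves.ModularForms Literature.NumberTheory.EllipticCurves.IwasawaAlgebra
  Literature.NumberTheory.EllipticCurves.Module

namespace Summit.BirchSwinnertonDyer.BirchSwinnertonDyer.Theorems.AddKatoTwo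

/-! ## §1 The exceptional prime and its conjugate are distinct away from `(2)` -/

/-- Numerals under `C : ℤ₂ → Λ`: `C n = n`. [folklore] -/
private theorem C_ofNat_eq (n : ℕ) [n.AtLeastTwo] :
    (PowerSeries.C (OfNat.ofNat n : ℤ_[2]) : IwasawaAlgebra 2) = (OfNat.ofNat n : IwasawaAlgebra 2) := by
  rw [← Nat.cast_ofNat (R := ℤ_[2]), map_natCast, Nat.cast_ofNat]

/-- `(1 + T) · ι(T − 4) = −(5T + 4)` in `Λ = ℤ₂⟦T⟧` (`ι T = (1+T)⁻¹ − 1`). [folklore] -/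
theorem one_add_X_mul_invol_X_sub_four :
    (1 + PowerSeries.X : IwasawaAlgebra 2) * invol 2 (PowerSeries.X - PowerSeries.C 4) =
      -(PowerSeries.C 5 * PowerSeries.X + PowerSeries.C 4) := by
  have h := one_add_X_mul_one_add_invSubOne 2
  rw [map_sub, invol_X, invol_C, C_ofNat_eq 4, C_ofNat_eq 5]
  linear_combination h

/-- `24 ∈ 𝔮 ⟹ C 2 ∈ 𝔮` for a prime `𝔮` of `Λ = ℤ₂⟦T⟧` (`24 = 2³·3`, `3` a unit). [folklore] -/
theorem C_two_mem_of_twentyfour_mem (𝔮 : PrimeSpectrum (IwasawaAlgebra 2))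
    (h : (24 : IwasawaAlgebra 2) ∈ 𝔮.asIdeal) : PowerSeries.C (2 : ℤ_[2]) ∈ 𝔮.asIdeal := by
  have h3norm : ‖(3 : ℤ_[2])‖ = 1 := by
    have h := (PadicInt.norm_natCast_eq_one_iff (p := 2) (n := 3)).mpr (by decide)
    simpa using h
  have h3 : IsUnit (PowerSeries.C (3 : ℤ_[2]) : IwasawaAlgebra 2) := by
    rw [PowerSeries.isUnit_iff_constantCoeff, PowerSeries.constantCoeff_C, PadicInt.isUnit_iff]
    exact h3norm
  have h24 : (24 : IwasawaAlgebra 2) = PowerSeries.C (2 : ℤ_[2]) ^ 3 * PowerSeries.C (3 : ℤ_[2]) := by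
    rw [C_ofNat_eq 2, C_ofNat_eq 3]; norm_num
  rw [h24] at h
  rcases 𝔮.isPrime.mem_or_mem h with h2 | h3'
  · exact 𝔮.isPrime.mem_of_pow_mem 3 h2
  · exact absurd (Ideal.eq_top_of_isUnit_mem _ h3' h3) 𝔮.isPrime.ne_top

/-- **`T − 4` and `ι(T − 4)` are not both in a prime `𝔮 ∌ 2`** (`(T−4) ≠ ι(T−4) ≐ (5T+4)` away from `(2)`):
if both lie in `𝔮` then `5(T−4)` and `(1+T)·ι(T−4) = −(5T+4)` do, hence `24 ∈ 𝔮`, hence `2 ∈ 𝔮`. [folklore] -/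
theorem not_mem_comap_invol_of_mem_X_sub_four (𝔮 : PrimeSpectrum (IwasawaAlgebra 2))
    (h2 : PowerSeries.C (2 : ℤ_[2]) ∉ 𝔮.asIdeal) :
    (PowerSeries.X - PowerSeries.C 4 : IwasawaAlgebra 2) ∉ 𝔮.asIdeal ∨
      (PowerSeries.X - PowerSeries.C 4 : IwasawaAlgebra 2) ∉
        (PrimeSpectrum.comap (invol 2).toRingHom 𝔮).asIdeal := by
  by_contra h
  rw [not_or, not_not, not_not] at h
  obtain ⟨hπ, hιπ⟩ := h
  rw [PrimeSpectrum.comap_asIdeal, Ideal.mem_comap] at hιπ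
  change invol 2 (PowerSeries.X - PowerSeries.C 4) ∈ 𝔮.asIdeal at hιπ
  apply h2
  apply C_two_mem_of_twentyfour_mem 𝔮
  have ha : (1 + PowerSeries.X : IwasawaAlgebra 2) * invol 2 (PowerSeries.X - PowerSeries.C 4) ∈
      𝔮.asIdeal := 𝔮.asIdeal.mul_mem_left _ hιπ
  rw [one_add_X_mul_invol_X_sub_four] at ha
  have hb : (PowerSeries.C 5 : IwasawaAlgebra 2) * (PowerSeries.X - PowerSeries.C 4) ∈ 𝔮.asIdeal :=
    𝔮.asIdeal.mul_mem_left _ hπ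
  have hsum := 𝔮.asIdeal.sub_mem (𝔮.asIdeal.neg_mem ha) hb
  have h24 : -(-(PowerSeries.C 5 * PowerSeries.X + PowerSeries.C 4)) -
      (PowerSeries.C 5 : IwasawaAlgebra 2) * (PowerSeries.X - PowerSeries.C 4) = 24 := by
    rw [C_ofNat_eq 5, C_ofNat_eq 4]; ring
  rwa [h24] at hsum

/-- **`5T + 4` and `ι(5T + 4)` are not both in a prime `𝔮 ∌ 2`**: `(1+T)·ι(5T+4) = −(T − 4)`, so both
memberships give `5T+4, T−4 ∈ 𝔮`, hence `24 ∈ 𝔮`. [folklore] -/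
theorem not_mem_comap_invol_of_mem_five_X_add_four (𝔮 : PrimeSpectrum (IwasawaAlgebra 2))
    (h2 : PowerSeries.C (2 : ℤ_[2]) ∉ 𝔮.asIdeal) :
    (PowerSeries.C 5 * PowerSeries.X + PowerSeries.C 4 : IwasawaAlgebra 2) ∉ 𝔮.asIdeal ∨
      (PowerSeries.C 5 * PowerSeries.X + PowerSeries.C 4 : IwasawaAlgebra 2) ∉
        (PrimeSpectrum.comap (invol 2).toRingHom 𝔮).asIdeal := by
  by_contra h
  rw [not_or, not_not, not_not] at h
  obtain ⟨hπ, hιπ⟩ := h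
  rw [PrimeSpectrum.comap_asIdeal, Ideal.mem_comap] at hιπ
  change invol 2 (PowerSeries.C 5 * PowerSeries.X + PowerSeries.C 4) ∈ 𝔮.asIdeal at hιπ
  apply h2
  apply C_two_mem_of_twentyfour_mem 𝔮
  have hid : (1 + PowerSeries.X : IwasawaAlgebra 2) *
      invol 2 (PowerSeries.C 5 * PowerSeries.X + PowerSeries.C 4) = -(PowerSeries.X - PowerSeries.C 4) := by
    have h := one_add_X_mul_one_add_invSubOne 2
    rw [map_add, map_mul, invol_X, invol_C, invol_C, C_ofNat_eq 5, C_ofNat_eq 4]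
    linear_combination (5 : IwasawaAlgebra 2) * h
  have ha : (1 + PowerSeries.X : IwasawaAlgebra 2) *
      invol 2 (PowerSeries.C 5 * PowerSeries.X + PowerSeries.C 4) ∈ 𝔮.asIdeal :=
    𝔮.asIdeal.mul_mem_left _ hιπ
  rw [hid] at ha
  have hb : (PowerSeries.C 5 : IwasawaAlgebra 2) * -(PowerSeries.X - PowerSeries.C 4) ∈ 𝔮.asIdeal :=
    𝔮.asIdeal.mul_mem_left _ ha
  have hsum := 𝔮.asIdeal.add_mem hπ hb
  have h24 : (PowerSeries.C 5 * PowerSeries.X + PowerSeries.C 4 : IwasawaAlgebra 2) +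
      PowerSeries.C 5 * -(PowerSeries.X - PowerSeries.C 4) = 24 := by
    rw [C_ofNat_eq 5, C_ofNat_eq 4]; ring
  rwa [h24] at hsum

/-! ## §2 Kato's divisibility at EVERY height-one prime `𝔮 ∌ 2` for the additive (−1)-block, from T20's inputs -/

/-- **Conj. 17.6's inequality `ℓ_𝔮(X(W/ℚ_∞)) ≤ ℓ_𝔮(Λ/(L̃))` at EVERY height-one `𝔮 ∌ 2` — the exceptional prime
of (12.5.1) included — for `W` additive at `2` with `W^{(−1)}` split multiplicative and `W[2]` irreducible**, GIVEN
(by name) Kato's Thm. 12.4 (2) `Kato2004.thm12_4` and the odd-branch package `KatoOddBranchInputsAtTwoNegOneSplitTwist`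
(T20 (b)), and (on the pinned objects) `ι(char D.X) = char D.X` (T20 (a): Greenberg 1.14 ×2 + twist decomposition)
and an integral multiple `L̃ = 2^m·L⁻ ∈ Λ`, `L̃ ≠ 0`, of the odd branch `L⁻ = padicLFunctionMinusBranchMult f 1 1`
with `(ι L̃) = (L̃)` (T20 (d): MTT §I.17). Off the factor's prime the package suffices; at it, transport
(`Kato2004.MultDivisibilityInputs.lengthAt_X_le_at_factor_of_transport`); §1 decides which case a given `𝔮` is in.
[cite: Kato2004Asterisque, Thm. 12.4 (2) (p. 221), Thm. 12.5 (3) and (12.5.1) (p. 222), Conj. 17.6 (p. 274), §17.13 (pp. 279–280)]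
[cite: GreenbergLNM1716, Thm. 1.14 (p. 68)] [cite: MazurTateTeitelbaum1986Invent, §I.17] -/
theorem lengthAt_selmerDual_le_of_oddBranchInputs (h12 : Kato2004.thm12_4)
    (hOB : KatoOddBranchInputsAtTwoNegOneSplitTwist)
    (W : WeierstrassCurve ℚ) [W.IsElliptic] [W.IsGloballyMinimal] [ContinuousSMul ℤ_[2] (W.tateModule 2)]
    {N : ℕ} [NeZero N] (f : CuspForm (Gamma0 N) 2) (κ : ZpExtension ℚ 2) (γ : absoluteGaloisGroup ℚ)
    (hsp : (W.quadraticTwist (-1)).HasSplitMultiplicativeReductionAtPrime 2)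
    (hirr : W.HasIrreducibleModPGaloisRep 2) (hκ : κ.IsCyclotomic) (hγ : κ.IsTopGenerator γ)
    (hγ' : IsCyclotomicVariable 2 γ) (hf : IsNewformOf (W.quadraticTwist (-1)) f)
    (I : Kato2004.IwasawaH1Data W 2 κ γ) (D : W.SelmerDualData κ γ)
    (hXι : (charIdeal (IwasawaAlgebra 2) D.X).map (invol 2).toRingHom = charIdeal (IwasawaAlgebra 2) D.X)
    (Lt : IwasawaAlgebra 2) (m : ℕ)
    (hLt : iwasawaToPowerSeries 2 Lt =
      PowerSeries.C ((2 : ℚ_[2]) ^ m) * padicLFunctionMinusBranchMult f (1 : ℚ_[2]) 1)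
    (hLt0 : Lt ≠ 0) (hLtι : (Ideal.span {Lt}).map (invol 2).toRingHom = Ideal.span {Lt})
    (𝔮 : PrimeSpectrum (IwasawaAlgebra 2)) (h𝔮 : 𝔮.asIdeal.height = 1)
    (hp𝔮 : PowerSeries.C (2 : ℤ_[2]) ∉ 𝔮.asIdeal) :
    lengthAt (IwasawaAlgebra 2) D.X 𝔮 ≤
      lengthAt (IwasawaAlgebra 2) (IwasawaAlgebra 2 ⧸ Ideal.span {Lt}) 𝔮 := by
  obtain ⟨π, hπ, K, -, -⟩ := hOB W f κ γ hsp hirr hκ hγ hγ' hf I D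
  have hp2 : ((2 : ℕ) : ℚ_[2]) = (2 : ℚ_[2]) := by norm_num
  have hLt' : iwasawaToPowerSeries 2 Lt =
      PowerSeries.C (((2 : ℕ) : ℚ_[2]) ^ m) * padicLFunctionMinusBranchMult f (1 : ℚ_[2]) 1 := by
    rw [hp2]; exact hLt
  have hp𝔮' : PowerSeries.C ((2 : ℕ) : ℤ_[2]) ∉ 𝔮.asIdeal := by exact_mod_cast hp𝔮
  -- which side of the dichotomy is `𝔮` on?
  have hdich : π ∉ 𝔮.asIdeal ∨ π ∉ (PrimeSpectrum.comap (invol 2).toRingHom 𝔮).asIdeal := by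
    rcases hπ with rfl | rfl
    · exact not_mem_comap_invol_of_mem_five_X_add_four 𝔮 hp𝔮
    · exact not_mem_comap_invol_of_mem_X_sub_four 𝔮 hp𝔮
  rcases hdich with hoff | hat
  · exact K.lengthAt_X_le_off_factor h12 hκ hγ hLt' hLt0 𝔮 h𝔮 hp𝔮' hoff
  · exact K.lengthAt_X_le_at_factor_of_transport h12 hκ hγ hLt' hLt0 𝔮 h𝔮 hp𝔮' hat hXι hLtι

end Summit.BirchSwinnertonDyer.BirchSwinnertonDyer.Theorems.AddKatoTwo

end
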